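import Summits.ValiantsHypothesis.ValiantsHypothesis.Theorems.SymPencilSingSixClassificationTheoremA
import Summits.ValiantsHypothesis.ValiantsHypothesis.Theorems.SymPencilPerFourExoticNoSixSquares
import Summits.ValiantsHypothesis.ValiantsHypothesis.Theorems.SymPencilPerFourCrossFilter
import Summits.ValiantsHypothesis.ValiantsHypothesis.Theorems.SymPencilPerFourTwoLineFilterLeaf
import Summits.ValiantsHypothesis.ValiantsHypothesis.Theorems.SymPencilSdcPerFourCellTenSix

/-!
# Route `SymPencil` — the V-side LIST is a THEOREM and the cell `(10, 6, 6)` of the size-`27`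
# kernel-package table is EMPTY (`--supports` stmt-ValiantsHypothesis-5674 `SdcSuperquadratic`;
# rung currency only — nothing here bears on `VP ≠ VNP`)

Assembly of the lanes of the cell val-width on the cell `(r, dim V, d) = (10, 6, 6)`:

* **THE LIST** (`sixDim_perDir_list`, unconditional): over a field of characteristic `0`, every
  `6`-dimensional linear `W ⊆ Sing Z(per₄)` all of whose elements `y` have the `s²`-coefficient of
  `per_4 (u + s y)` a combination of `≤ 6` squares of linear functionals of `u`
  (`PerDirSix`) is of `V×`-, `W_col`- or `W₂`-type, or transposed.  It is val-idea-18's composition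
  `SymPencilSingSixClassification.sixDim_perDir_list_of` (port of the crux workfile
  `Lines/sing_six_classification.lean`, Theorem A = leaves 1–2 by val-idea-18 g3/g4) fed with the
  three Hessian-rank leaves landed by this seat: `SymPencilPerFourExoticNoSixSquares.stub_exoticNoSixSquares`
  (leaf 3), `SymPencilPerFourCrossFilter.stub_crossFilter` (leaf 4),
  `SymPencilPerFourTwoLineFilterLeaf.stub_twoLineFilter` (leaf 5).
* **THE CELL** (`false_of_rank_ten_le_twentySeven`): in the base-point package of a symmetric
  affine determinantal representation of `per_4` of size `m ≤ 27` over an algebraically closed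
  field of characteristic `0`, the space of kernel rows is NOT `10`-dimensional — the LIST plugged
  into `SymPencilSdcPerFourCellTenSix.false_of_rank_ten_le_twentySeven` (the three pencil kills of
  val-width-5674-w2 g0: `SymPencilPerFourCrossSix`, `…ColSix`, `…W2` + transports).  Size bounds
  descend to any field of characteristic `0` by `SymPencilBasePointDetConst.le_size_of_algebraicClosure`
  when the size-`27` table is assembled.

Honest framing: ONE of the six cells of the size-`27` table is closed; the cells `(8,8,10)`,
`(9,7,8)`, `(11,5,4)`, `(12,4,2)`, `(13,3,0)` remain, so the window `27 ≤ sdc(per₄) ≤ 29` is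
UNCHANGED; stmt-5674 `SdcSuperquadratic` (superquadratic `sdc(per_n)`) stays OPEN; `VP ≠ VNP` is not
moved; no summit statement is proved here.  No definitions, no named facts. [folklore]
-/

noncomputable section

-- single-conjunct layout: Sub = Summit, duplicated namespace component intended
set_option linter.dupNamespace false

namespace Summit.ValiantsHypothesis.ValiantsHypothesis.Theorems.SymPencilSdcPerFourCellTenSixClosed

open Matrix MvPolynomial Module
open Literature.Computability.AlgebraicComplexity
open Summit.ValiantsHypothesis.ValiantsHypothesis.Theorems.SymPencilSingSixClassification
open Summit.ValiantsHypothesis.ValiantsHypothesis.Theorems.SymPencilSdcPerFourCellTenSix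

universe u

variable {K : Type*} [Field K]

/-- **THE LIST** (V-side list of cell `(10,6,6)`, unconditional): `Sing3 W`, `finrank W = 6`,
`PerDirSix W` ⇒ `VCrossType W ∨ WColType W ∨ W2Type W ∨ WColTypeT W ∨ W2TypeT W`. [folklore] -/
theorem sixDim_perDir_list [CharZero K] :
    ∀ W : Submodule K (Fin 4 × Fin 4 → K), Sing3 W → finrank K W = 6 → PerDirSix W →
      VCrossType W ∨ WColType W ∨ W2Type W ∨ WColTypeT W ∨ W2TypeT W :=
  sixDim_perDir_list_of zeroLine zeroLineResidue
    (fun W h => SymPencilPerFourExoticNoSixSquares.stub_exoticNoSixSquares W h)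
    (fun W h6 hX hP => SymPencilPerFourCrossFilter.stub_crossFilter W h6 hX hP)
    (fun W h6 h hP => SymPencilPerFourTwoLineFilterLeaf.stub_twoLineFilter W h6 h hP)

/-- **THE LIST in the joint form** (all predicates unfolded), as consumed by the cell theorem.
[folklore] -/
theorem jointList [CharZero K] :
    ∀ W : Submodule K (Fin 4 × Fin 4 → K),
      (∀ x ∈ W, ∀ (r c : Fin 3 → Fin 4), Function.Injective r → Function.Injective c →
        ((Matrix.of fun i j => x (i, j)).submatrix r c).permanent = 0) →
      finrank K W = 6 →
      (∃ (c : Fin 6 → K) (β : Fin 6 → ((Fin 4 × Fin 4 → K) →ₗ[K] (Fin 4 × Fin 4 → K) →ₗ[K] K)),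
        ∀ u : Fin 4 × Fin 4 → K, ∀ y ∈ W, ∃ e₀ e₁ : K, ∀ s : K,
          eval (u + s • y) (perPoly (Fin 4) K) = e₀ + s * e₁ + s ^ 2 * ∑ j, c j * (β j u y) ^ 2) →
      (∃ (l c : Fin 4) (e : Fin 4 × Fin 4), (e.1 = l ∨ e.2 = c) ∧ e ≠ (l, c) ∧
          ∀ x : Fin 4 × Fin 4 → K, x ∈ W ↔
            ((∀ i j : Fin 4, i ≠ l → j ≠ c → x (i, j) = 0) ∧ x e = 0)) ∨
      (∃ p q m : Fin 4, p ≠ q ∧ ∀ x : Fin 4 × Fin 4 → K, x ∈ W ↔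
          ((∀ i j : Fin 4, i ≠ p → i ≠ q → x (i, j) = 0) ∧ x (p, m) = 0 ∧ x (q, m) = 0)) ∨
      (∃ p q m m' : Fin 4, p ≠ q ∧ m ≠ m' ∧ ∀ x : Fin 4 × Fin 4 → K, x ∈ W ↔
          ((∀ i j : Fin 4, i ≠ p → i ≠ q → x (i, j) = 0) ∧ x (q, m) = 0 ∧ x (q, m') = 0)) ∨
      (∃ p q m : Fin 4, p ≠ q ∧ ∀ x : Fin 4 × Fin 4 → K, x ∈ W ↔
          ((∀ i j : Fin 4, j ≠ p → j ≠ q → x (i, j) = 0) ∧ x (m, p) = 0 ∧ x (m, q) = 0)) ∨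
      (∃ p q m m' : Fin 4, p ≠ q ∧ m ≠ m' ∧ ∀ x : Fin 4 × Fin 4 → K, x ∈ W ↔
          ((∀ i j : Fin 4, j ≠ p → j ≠ q → x (i, j) = 0) ∧ x (m, q) = 0 ∧ x (m', q) = 0)) :=
  jointList_of_perDirList (fun W hS h6 hP => sixDim_perDir_list W hS h6 hP)

/-- **THE CELL `(10, 6, 6)` IS EMPTY**: no base-point package of a symmetric affine determinantal
representation of `per_4` of size `m ≤ 27` over an algebraically closed field of characteristic
`0` has a `10`-dimensional space of kernel rows (hypotheses exactly as exported by
`SymPencilPerFourBasePointPackage.basepoint_package_of_isSymm_isAffineDetRepr_perPoly_four`).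
[folklore] -/
theorem false_of_rank_ten_le_twentySeven (K : Type*) [Field K] [CharZero K] [IsAlgClosed K]
    {m : ℕ} (hm : m ≤ 27)
    {i₀ : Fin m} {D : Matrix {i // i ≠ i₀} {i // i ≠ i₀} K}
    {bL : (Fin 4 × Fin 4 → K) →ₗ[K] ({i // i ≠ i₀} → K)}
    {CL : (Fin 4 × Fin 4 → K) →ₗ[K] Matrix {i // i ≠ i₀} {i // i ≠ i₀} K} {κ : K}
    (hD : IsUnit D.det) (hDs : Dᵀ = D) (hCs : ∀ z, (CL z)ᵀ = CL z) (hκ : κ ≠ 0)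
    (hi : ∀ z, bL z ⬝ᵥ D⁻¹ *ᵥ bL z = 0)
    (hii : ∀ z, bL z ⬝ᵥ (D⁻¹ * CL z * D⁻¹) *ᵥ bL z = 0)
    (hiii : ∀ z, D.det * (bL z ⬝ᵥ (D⁻¹ * CL z * D⁻¹ * CL z * D⁻¹) *ᵥ bL z) =
      -(κ * eval z (perPoly (Fin 4) K)))
    (hV4 : ∀ x ∈ LinearMap.ker bL, ∀ r c : Fin 4,
      ((Matrix.of fun i j => x (i, j)).submatrix r.succAbove c.succAbove).permanent = 0)
    (hcard : Fintype.card {i // i ≠ i₀} + 1 = m)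
    (hrn : finrank K (LinearMap.range bL) + finrank K (LinearMap.ker bL) = 16)
    (hN : ∀ v, bL v = 0 → IsUnit (D + CL v).det ∧ ∀ (z : Fin 4 × Fin 4 → K) (s : K),
      κ * eval (v + s • z) (perPoly (Fin 4) K) =
        (Matrix.fromBlocks ((s * 0) • (1 : Matrix Unit Unit K))
          (Matrix.replicateRow Unit (s • bL z)) (Matrix.replicateCol Unit (s • bL z))
          (D + CL v + s • CL z)).det)
    (h10 : finrank K (LinearMap.range bL) = 10) : False :=
  SymPencilSdcPerFourCellTenSix.false_of_rank_ten_le_twentySeven K hm hD hDs hCs hκ hi hii hiii hV4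
    hcard hrn hN jointList h10

end Summit.ValiantsHypothesis.ValiantsHypothesis.Theorems.SymPencilSdcPerFourCellTenSixClosed

end
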